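import Summits.HodgeConjecture.CorCM.PairFlipCMFieldsSplitOffHodge
import Summits.HodgeConjecture.CorCM.CMAbelianFactorsDimLeThreeClassification
import HarnessLib

/-!
# Complex abelian varieties of CM type all of whose simple isogeny factors are GENERIC (endomorphism fields with pair flips)
# with pairwise distinct Galois closures: all powers are divisor-generated and the Hodge conjecture holds on everything they
# dominate — every dimension, read on the variety

COR-CM (cell `pub-hodgecm2`, binder seat `b16` gen 44, count-neutral claim CM-DIMLE3-INTRINSIC, file F6; theorems only, no
definition, no named fact, no `sorry`).  NEW as stated, hence under `Summits/`.  HONEST FRAMING: an unconditional theorem on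
complex abelian varieties of CM type of arbitrary dimension; not a step of the summit chain (`HC_CM` is neither used nor
advanced).  The INTRINSIC form of `CorCM/PairFlipCMFieldsSplitOffHodge` (F5), through the reduction
`isDivisorGenerated_of_avDominatedBy_powSucc_of_forall_factorFamily` of `CorCM/CMAbelianFactorsDimLeThreeClassification` (F2).

THE THEOREM (`isDivisorGenerated_of_avDominatedBy_powSucc_of_isOfCMType_of_pairFlip_factors`).  Let `X` be a complex abelian
variety of CM type (`Milne1999.IsOfCMType`).  Suppose that every simple isogeny factor `B` of `X` of positive dimension is
GENERIC in the sense that the complex ring maps `End⁰(B) → ℂ` have PAIR FLIPS — every conjugate pair `{f, f̄}` is exchanged by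
an automorphism of `ℂ` fixing all the other maps (this holds when `End⁰(B)` is a CM field with Galois group `C₂ ≀ 𝔖_g`, the
generic case in every dimension `g`; for threefolds: Galois closure of degree `24` or `48`) — and that two NON-ISOGENOUS such
factors have DIFFERENT intrinsic Galois closures `⨆_{f : End⁰(B) →+* ℂ} ℚ(range f) ≤ ℂ`.  Then every complex abelian
variety dominated by a power of `X` is divisor-generated (`B• = D• ⊗ ℂ`), and
(`hodgeConjectureFor_of_avDominatedBy_powSucc_of_isOfCMType_of_pairFlip_factors`) satisfies the Hodge conjecture,
UNCONDITIONALLY — whatever the dimensions of the factors.  (In a family of simple, pairwise non-isogenous factors of `X` every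
slot inherits the pair flips through `End⁰ ≅ K` (`pairFlip_of_ringEquiv`) and the closures are pairwise distinct, so F5's
`isNondegenerateFamily_pairFlip_of_normalClosure_ne` applies.)

THE SYNTHESIS with the census of `CorCM/CMAbelianFactorsDimLeThreeClassification` (§3–§4,
`isDivisorGenerated_of_avDominatedBy_powSucc_of_isOfCMType_of_bigGeneric_smallCensus`): it suffices that every simple isogeny
factor of dimension `≥ 4` is generic, that two non-isogenous factors of dimension `≥ 4` have different intrinsic closures not
contained in the closure of any factor of dimension `≤ 3`, and that the factors satisfy the census conditions (i′), (ii′), (iii′)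
of that file — then again everything dominated by a power of `X` is divisor-generated and satisfies the Hodge conjecture (the
slots of dimension `≥ 4` split off, F5; the slots of dimension `≤ 3` are decided by the census, §3
`isNondegenerateFamily_of_factors_dim_le_three`).  With no factor of dimension `≥ 4` this is F2; with none of dimension `≤ 3`, §2.

## References

* [Gordon1999HodgeAVSurvey] B. B. Gordon, *A survey of the Hodge conjecture for abelian varieties*, §3 Theorem, 7.5–7.7,
  10.10.
* [Dodson1984] B. Dodson, *The structure of Galois groups of CM-fields*, Trans. AMS 283 (1984), §1.1, §5.1.2.
* [MumfordAV1970] D. Mumford, *Abelian Varieties*, §19 Thm. 1, Cor. 1–2 (pp. 173–174).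
* [Shimura1998] G. Shimura, *Abelian Varieties with Complex Multiplication and Modular Functions*, §5.1 Props. 3–6, §8.4.
* [MoonenZarhin1999LowDim] B. Moonen, Yu. Zarhin, *Hodge classes on abelian varieties of low dimension*, Math. Ann. 315
  (1999), Thms. (0.1), (0.2), §3.
-/

noncomputable section

open CategoryTheory CategoryTheory.Limits NumberField Module IntermediateField

namespace Summit.HodgeConjecture.CorCM

open Literature.NumberTheory.ComplexMultiplication
open Literature.AlgebraicGeometry.Motives (AbelianVariety CMType)
open Literature.AlgebraicGeometry.Motives.AbelianVariety
open Literature.AlgebraicGeometry.HodgeTheory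
open Literature.AlgebraicGeometry.ComplexMultiplication (IsCMTypeRealisation)
open Literature.AlgebraicGeometry.Milne1999
open Literature.AlgebraicGeometry.Pohlmann1968
open Summit.HodgeConjecture.CorCM.Domination
open Summit.HodgeConjecture.HodgeConjecture.Ring2.ClassTargets (HCOnClass)
open Summit.HodgeConjecture.HodgeConjecture.Ring2.Atlas (nonempty_ringEquiv_endAlgebra_of_isSimple)

/-! ## §1 Pair flips transported along a ring isomorphism -/

section Transport

/-- **Pair flips are intrinsic**: if the complex ring maps out of a ring `R` have pair flips and `e : K ≃+* R`, then so do
the complex embeddings of `K` (re-index along `s ↦ s ∘ e⁻¹`). [folklore] -/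
theorem pairFlip_of_ringEquiv {K : Type} [Field K] {R : Type} [Ring R] (e : K ≃+* R)
    (h : ∀ f : R →+* ℂ, ∃ σ : ℂ ≃+* ℂ, σ • f = (starRingAut : ℂ ≃+* ℂ) • f ∧
      ∀ g : R →+* ℂ, g ≠ f → g ≠ (starRingAut : ℂ ≃+* ℂ) • f → σ • g = g) :
    ∀ s : K →+* ℂ, ∃ σ : ℂ ≃+* ℂ, σ • s = (starRingAut : ℂ ≃+* ℂ) • s ∧
      ∀ t : K →+* ℂ, t ≠ s → t ≠ (starRingAut : ℂ ≃+* ℂ) • s → σ • t = t := by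
  intro s
  obtain ⟨σ, hσ, hfix⟩ := h (s.comp e.symm.toRingHom)
  -- re-indexing: `u ↦ u ∘ e⁻¹` is injective and compatible with the action
  have key : ∀ (τ : ℂ ≃+* ℂ) (u : K →+* ℂ), (τ • u).comp e.symm.toRingHom = τ • u.comp e.symm.toRingHom :=
    fun τ u => rfl
  have inj : ∀ u v : K →+* ℂ, u.comp e.symm.toRingHom = v.comp e.symm.toRingHom → u = v := by
    intro u v huv
    ext x
    have := RingHom.congr_fun huv (e x)
    simpa using this
  refine ⟨σ, inj _ _ (by rw [key, hσ, ← key]), fun t ht ht' => inj _ _ ?_⟩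
  rw [key]
  refine hfix _ (fun h => ht (inj _ _ h)) (fun h => ht' (inj _ _ ?_))
  rw [key]
  exact h

end Transport

variable {X : AbelianVariety ℂ}

/-! ## §2 Generic simple factors with distinct closures -/

section Generic

/-- **MASTER FORM — generic factors.**  Let `X` be a complex abelian variety of CM type whose simple isogeny factors of
positive dimension all have endomorphism algebras with PAIR FLIPS on their complex ring maps, two non-isogenous ones having
different intrinsic Galois closures.  Then every complex abelian variety dominated by a power `X^{N+1}` is
divisor-generated — every dimension, any number of factors. [cite: Gordon1999HodgeAVSurvey, §3 Theorem, 7.5–7.7]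
[cite: Dodson1984, §1.1 and §5.1.2] [cite: Shimura1998, §5.1 Props. 3–6] -/
theorem isDivisorGenerated_of_avDominatedBy_powSucc_of_isOfCMType_of_pairFlip_factors (hcm : IsOfCMType X)
    (hflip : ∀ B : AbelianVariety ℂ, B.IsSimple → 0 < B.dim → AVDominatedBy B X →
      ∀ f : B.endAlgebra →+* ℂ, ∃ σ : ℂ ≃+* ℂ, σ • f = (starRingAut : ℂ ≃+* ℂ) • f ∧
        ∀ g : B.endAlgebra →+* ℂ, g ≠ f → g ≠ (starRingAut : ℂ ≃+* ℂ) • f → σ • g = g)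
    (hne : ∀ B B' : AbelianVariety ℂ, B.IsSimple → B'.IsSimple → 0 < B.dim → 0 < B'.dim →
      AVDominatedBy B X → AVDominatedBy B' X → ¬ IsIsogenous B B' →
      (⨆ f : B.endAlgebra →+* ℂ, IntermediateField.adjoin ℚ (Set.range f)) ≠
        ⨆ f : B'.endAlgebra →+* ℂ, IntermediateField.adjoin ℚ (Set.range f))
    {B : AbelianVariety ℂ} {N : ℕ} (hB : AVDominatedBy B (X.powSucc N)) : IsDivisorGenerated B := by
  classical
  refine isDivisorGenerated_of_avDominatedBy_powSucc_of_forall_factorFamily hcm ?_ hB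
  intro C _ _ K' _ _ _ Φ' A' ι' θ' hA hs hniso hslot
  have heC : ∀ c, Nonempty (K' c ≃+* (A' c).endAlgebra) := fun c =>
    nonempty_ringEquiv_endAlgebra_of_isSimple (hA c) (hs c)
  have hpos : ∀ c, 0 < (A' c).dim := fun c => by
    have h := finrank_eq_two_mul_dim_of_isCMTypeRealisation (hA c)
    have hp : 0 < finrank ℚ (K' c) := Module.finrank_pos
    omega
  refine isNondegenerateFamily_pairFlip_of_normalClosure_ne (Φ := Φ') (fun c => ?_) (fun c c' hcc' hL => ?_)
  · obtain ⟨e⟩ := heC c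
    exact pairFlip_of_ringEquiv e (hflip _ (hs c) (hpos c) (hslot c))
  · obtain ⟨e⟩ := heC c
    obtain ⟨e'⟩ := heC c'
    refine hne _ _ (hs c) (hs c') (hpos c) (hpos c') (hslot c) (hslot c') (hniso c c' hcc') ?_
    rw [iSup_adjoin_range_eq_normalClosure e, iSup_adjoin_range_eq_normalClosure e', hL]

/-- **The Hodge conjecture for everything dominated by a power of a CM abelian variety with generic simple factors of
pairwise distinct closures** — all Hodge classes polynomials in divisor classes, UNCONDITIONALLY, every dimension.
[cite: Gordon1999HodgeAVSurvey, §3 Theorem and 10.10] [cite: Dodson1984, §1.1] -/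
theorem hodgeConjectureFor_of_avDominatedBy_powSucc_of_isOfCMType_of_pairFlip_factors (hcm : IsOfCMType X)
    (hflip : ∀ B : AbelianVariety ℂ, B.IsSimple → 0 < B.dim → AVDominatedBy B X →
      ∀ f : B.endAlgebra →+* ℂ, ∃ σ : ℂ ≃+* ℂ, σ • f = (starRingAut : ℂ ≃+* ℂ) • f ∧
        ∀ g : B.endAlgebra →+* ℂ, g ≠ f → g ≠ (starRingAut : ℂ ≃+* ℂ) • f → σ • g = g)
    (hne : ∀ B B' : AbelianVariety ℂ, B.IsSimple → B'.IsSimple → 0 < B.dim → 0 < B'.dim →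
      AVDominatedBy B X → AVDominatedBy B' X → ¬ IsIsogenous B B' →
      (⨆ f : B.endAlgebra →+* ℂ, IntermediateField.adjoin ℚ (Set.range f)) ≠
        ⨆ f : B'.endAlgebra →+* ℂ, IntermediateField.adjoin ℚ (Set.range f))
    {B : AbelianVariety ℂ} {N : ℕ} (hB : AVDominatedBy B (X.powSucc N)) : HodgeConjectureFor B.dim B.X :=
  hodgeConjectureFor_of_isDivisorGenerated _
    (isDivisorGenerated_of_avDominatedBy_powSucc_of_isOfCMType_of_pairFlip_factors hcm hflip hne hB)

/-- **Class-target display** (`Ring2.ClassTargets.HCOnClass`): the Hodge conjecture on the class of complex abelian varieties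
dominated by a power of a CM abelian variety with generic simple factors of pairwise distinct intrinsic Galois closures.
UNCONDITIONAL. [cite: Gordon1999HodgeAVSurvey, §3 Theorem and 10.10] -/
theorem hcOnClass_avDominatedBy_powSucc_isOfCMType_pairFlip_factors :
    HCOnClass fun B => ∃ (X : AbelianVariety ℂ) (N : ℕ), IsOfCMType X ∧
      (∀ B : AbelianVariety ℂ, B.IsSimple → 0 < B.dim → AVDominatedBy B X →
        ∀ f : B.endAlgebra →+* ℂ, ∃ σ : ℂ ≃+* ℂ, σ • f = (starRingAut : ℂ ≃+* ℂ) • f ∧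
          ∀ g : B.endAlgebra →+* ℂ, g ≠ f → g ≠ (starRingAut : ℂ ≃+* ℂ) • f → σ • g = g) ∧
      (∀ B B' : AbelianVariety ℂ, B.IsSimple → B'.IsSimple → 0 < B.dim → 0 < B'.dim →
        AVDominatedBy B X → AVDominatedBy B' X → ¬ IsIsogenous B B' →
        (⨆ f : B.endAlgebra →+* ℂ, IntermediateField.adjoin ℚ (Set.range f)) ≠
          ⨆ f : B'.endAlgebra →+* ℂ, IntermediateField.adjoin ℚ (Set.range f)) ∧
      AVDominatedBy B (X.powSucc N) :=
  fun _ ⟨_, _, hcm, hflip, hne, hB⟩ =>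
    hodgeConjectureFor_of_avDominatedBy_powSucc_of_isOfCMType_of_pairFlip_factors hcm hflip hne hB

end Generic

/-! ## §3 The census on a family of small factors of `X`, from the intrinsic conditions -/

section FamilyCensus

/-- A ring isomorphism of number fields preserves the degree. [folklore] -/
private theorem finrank_eq_of_ringEquiv'' {K K' : Type} [Field K] [NumberField K] [Field K'] [NumberField K']
    (e : K ≃+* K') : finrank ℚ K = finrank ℚ K' :=
  (AlgEquiv.ofRingEquiv (f := e) fun q => by rw [eq_ratCast]; exact map_ratCast e q).toLinearEquiv.finrank_eq

variable {C : Type} [Fintype C] [DecidableEq C] [Nonempty C] {K' : C → Type} [∀ c, Field (K' c)] [∀ c, NumberField (K' c)]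
  [∀ c, IsCMField (K' c)] {Φ' : ∀ c, CMType (K' c)} {A' : C → AbelianVariety ℂ} {ι' : ∀ c, 𝓞 (K' c) →+* End (A' c)}
  {θ' : ∀ c, K' c →+* Module.End ℂ (complexBetti (A' c).X 1)}

open scoped Classical in
/-- **The census on a family of factors, from the intrinsic conditions.**  A family of SIMPLE, pairwise non-isogenous CM
realisations of dimension `≤ 3`, all isogeny factors of a complex abelian variety `X` satisfying (i′), (ii′), (iii′), is
nondegenerate: a violating pair / quadruple / triple of slots would be, through `End⁰ ≅ K` (Shimura §5.1), a configuration of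
factors of `X` excluded by (i′) / (ii′) / (iii′).  (The family-level form of the master step of
`CorCM/CMAbelianFactorsDimLeThreeClassification`.) [cite: MoonenZarhin1999LowDim, Thm. (0.2) and §3]
[cite: Gordon1999HodgeAVSurvey, 7.5–7.7 and 9.4] [cite: Shimura1998, §5.1 Props. 3–6 and §8.4] -/
theorem isNondegenerateFamily_of_factors_dim_le_three (hA : ∀ c, IsCMTypeRealisation (Φ' c) (A' c) (ι' c) (θ' c))
    (hs : ∀ c, (A' c).IsSimple) (hniso : ∀ c c', c ≠ c' → ¬ IsIsogenous (A' c) (A' c'))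
    (hslot : ∀ c, AVDominatedBy (A' c) X) (h3c : ∀ c, (A' c).dim ≤ 3)
    (hi : ¬ ∃ (B B' : AbelianVariety ℂ) (k : Type) (_ : Field k) (_ : NumberField k),
      B.IsSimple ∧ B'.IsSimple ∧ 0 < B.dim ∧ 0 < B'.dim ∧ AVDominatedBy B X ∧ AVDominatedBy B' X ∧
      ¬ IsIsogenous B B' ∧ IsTotallyComplex k ∧ finrank ℚ k = 2 ∧
      Nonempty (k →+* B.endAlgebra) ∧ Nonempty (k →+* B'.endAlgebra))
    (hii : ¬ ∃ T : Fin 4 → AbelianVariety ℂ, (∀ a, (T a).IsSimple ∧ (T a).dim = 3 ∧ AVDominatedBy (T a) X) ∧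
      (∀ a b, a ≠ b → ¬ IsIsogenous (T a) (T b)) ∧ ∀ a b, Nonempty ((T a).endAlgebra ≃+* (T b).endAlgebra))
    (hiii : ¬ ∃ S : Fin 3 → AbelianVariety ℂ, (∀ a, (S a).IsSimple ∧ (S a).dim = 2 ∧ AVDominatedBy (S a) X) ∧
      (∀ a b, a ≠ b → ¬ IsIsogenous (S a) (S b)) ∧
      ∀ a b, (⨆ f : (S a).endAlgebra →+* ℂ, IntermediateField.adjoin ℚ (Set.range f)) =
        ⨆ f : (S b).endAlgebra →+* ℂ, IntermediateField.adjoin ℚ (Set.range f)) :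
    CMAlgebra.IsNondegenerateFamily Φ' := by
  classical
  have heC : ∀ c, Nonempty (K' c ≃+* (A' c).endAlgebra) := fun c =>
    nonempty_ringEquiv_endAlgebra_of_isSimple (hA c) (hs c)
  have hpos : ∀ c, 0 < (A' c).dim := fun c => by
    have h := finrank_eq_two_mul_dim_of_isCMTypeRealisation (hA c)
    have hp : 0 < finrank ℚ (K' c) := Module.finrank_pos
    omega
  refine isNondegenerateFamily_simpleFamily_dim_le_three hA hs hniso h3c ?_ ?_ ?_
  · rintro a b hab ⟨F, hF2, hFc, ⟨g⟩⟩
    obtain ⟨ea⟩ := heC a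
    obtain ⟨eb⟩ := heC b
    exact hi ⟨A' a, A' b, F, inferInstance, inferInstance, hs a, hs b, hpos a, hpos b, hslot a, hslot b, hniso a b hab,
      hFc, hF2, ⟨ea.toRingHom.comp F.val.toRingHom⟩, ⟨eb.toRingHom.comp g⟩⟩
  · intro a h6
    by_contra hlt
    push Not at hlt
    obtain ⟨d, hd, hdmem⟩ := exists_injective_fin_of_le_card (n := 4) (by omega : 4 ≤ _) (s := Finset.univ.filter
      fun b => Nonempty (K' b ≃+* K' a))
    have heK : ∀ x, Nonempty (K' (d x) ≃+* K' a) := fun x => (Finset.mem_filter.1 (hdmem x)).2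
    have h3d : ∀ x, (A' (d x)).dim = 3 := fun x => by
      obtain ⟨e⟩ := heK x
      have h := finrank_eq_two_mul_dim_of_isCMTypeRealisation (hA (d x))
      rw [finrank_eq_of_ringEquiv'' e, h6] at h
      omega
    refine hii ⟨fun x => A' (d x), fun x => ⟨hs (d x), h3d x, hslot (d x)⟩, fun x y hxy => hniso _ _ (hd.ne hxy),
      fun x y => ?_⟩
    obtain ⟨ex⟩ := heC (d x)
    obtain ⟨ey⟩ := heC (d y)
    obtain ⟨ux⟩ := heK x
    obtain ⟨uy⟩ := heK y
    exact ⟨(ex.symm.trans (ux.trans uy.symm)).trans ey⟩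
  · intro a h4
    by_contra hlt
    push Not at hlt
    obtain ⟨d, hd, hdmem⟩ := exists_injective_fin_of_le_card (n := 3) (by omega : 3 ≤ _) (s := Finset.univ.filter
      fun b => normalClosure ℚ (K' b) ℂ = normalClosure ℚ (K' a) ℂ)
    have hLK : ∀ x, normalClosure ℚ (K' (d x)) ℂ = normalClosure ℚ (K' a) ℂ := fun x => (Finset.mem_filter.1 (hdmem x)).2
    have h2d : ∀ x, (A' (d x)).dim = 2 := fun x => by
      have h := finrank_eq_two_mul_dim_of_isCMTypeRealisation (hA (d x))
      rw [finrank_eq_of_normalClosure_eq hA h3c (hLK x), h4] at h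
      omega
    refine hiii ⟨fun x => A' (d x), fun x => ⟨hs (d x), h2d x, hslot (d x)⟩, fun x y hxy => hniso _ _ (hd.ne hxy),
      fun x y => ?_⟩
    obtain ⟨ex⟩ := heC (d x)
    obtain ⟨ey⟩ := heC (d y)
    change (⨆ f : (A' (d x)).endAlgebra →+* ℂ, IntermediateField.adjoin ℚ (Set.range f)) =
      ⨆ f : (A' (d y)).endAlgebra →+* ℂ, IntermediateField.adjoin ℚ (Set.range f)
    rw [iSup_adjoin_range_eq_normalClosure ex, iSup_adjoin_range_eq_normalClosure ey, hLK x, hLK y]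

end FamilyCensus

/-! ## §4 Big factors generic and split off, small factors decided by the census -/

section Synthesis

/-- **MASTER FORM — big generic factors and small factors.**  Let `X` be a complex abelian variety of CM type such that:
every simple isogeny factor of dimension `≥ 4` is GENERIC (pair flips on the complex ring maps `End⁰ → ℂ`); two non-isogenous
factors of dimension `≥ 4` have different intrinsic Galois closures, and the closure of a factor of dimension `≥ 4` is not
contained in the closure of a factor of dimension `≤ 3`; and the census conditions (i′), (ii′), (iii′) hold.  Then every
complex abelian variety dominated by a power `X^{N+1}` is divisor-generated — every dimension.  (Reduction to a family of
factors; the slots of dimension `≥ 4` are generic with the closure hypotheses and split off, F5; the slots of dimension `≤ 3`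
form a nondegenerate family by the census, §3.) [cite: MoonenZarhin1999LowDim, Thm. (0.2) and §3]
[cite: Gordon1999HodgeAVSurvey, §3 Theorem, 7.5–7.7 and 9.4] [cite: Dodson1984, §1.1 and §5.1.2] -/
theorem isDivisorGenerated_of_avDominatedBy_powSucc_of_isOfCMType_of_bigGeneric_smallCensus (hcm : IsOfCMType X)
    (hbig : ∀ B : AbelianVariety ℂ, B.IsSimple → AVDominatedBy B X → 3 < B.dim →
      ∀ f : B.endAlgebra →+* ℂ, ∃ σ : ℂ ≃+* ℂ, σ • f = (starRingAut : ℂ ≃+* ℂ) • f ∧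
        ∀ g : B.endAlgebra →+* ℂ, g ≠ f → g ≠ (starRingAut : ℂ ≃+* ℂ) • f → σ • g = g)
    (hG1 : ∀ B B' : AbelianVariety ℂ, B.IsSimple → B'.IsSimple → AVDominatedBy B X → AVDominatedBy B' X →
      3 < B.dim → 3 < B'.dim → ¬ IsIsogenous B B' →
      (⨆ f : B.endAlgebra →+* ℂ, IntermediateField.adjoin ℚ (Set.range f)) ≠
        ⨆ f : B'.endAlgebra →+* ℂ, IntermediateField.adjoin ℚ (Set.range f))
    (hG2 : ∀ B B' : AbelianVariety ℂ, B.IsSimple → B'.IsSimple → AVDominatedBy B X → AVDominatedBy B' X →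
      3 < B.dim → 0 < B'.dim → B'.dim ≤ 3 →
      ¬ (⨆ f : B.endAlgebra →+* ℂ, IntermediateField.adjoin ℚ (Set.range f)) ≤
        ⨆ f : B'.endAlgebra →+* ℂ, IntermediateField.adjoin ℚ (Set.range f))
    (hi : ¬ ∃ (B B' : AbelianVariety ℂ) (k : Type) (_ : Field k) (_ : NumberField k),
      B.IsSimple ∧ B'.IsSimple ∧ 0 < B.dim ∧ 0 < B'.dim ∧ AVDominatedBy B X ∧ AVDominatedBy B' X ∧
      ¬ IsIsogenous B B' ∧ IsTotallyComplex k ∧ finrank ℚ k = 2 ∧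
      Nonempty (k →+* B.endAlgebra) ∧ Nonempty (k →+* B'.endAlgebra))
    (hii : ¬ ∃ T : Fin 4 → AbelianVariety ℂ, (∀ a, (T a).IsSimple ∧ (T a).dim = 3 ∧ AVDominatedBy (T a) X) ∧
      (∀ a b, a ≠ b → ¬ IsIsogenous (T a) (T b)) ∧ ∀ a b, Nonempty ((T a).endAlgebra ≃+* (T b).endAlgebra))
    (hiii : ¬ ∃ S : Fin 3 → AbelianVariety ℂ, (∀ a, (S a).IsSimple ∧ (S a).dim = 2 ∧ AVDominatedBy (S a) X) ∧
      (∀ a b, a ≠ b → ¬ IsIsogenous (S a) (S b)) ∧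
      ∀ a b, (⨆ f : (S a).endAlgebra →+* ℂ, IntermediateField.adjoin ℚ (Set.range f)) =
        ⨆ f : (S b).endAlgebra →+* ℂ, IntermediateField.adjoin ℚ (Set.range f))
    {B : AbelianVariety ℂ} {N : ℕ} (hB : AVDominatedBy B (X.powSucc N)) : IsDivisorGenerated B := by
  classical
  refine isDivisorGenerated_of_avDominatedBy_powSucc_of_forall_factorFamily hcm ?_ hB
  intro C _ _ K' _ _ _ Φ' A' ι' θ' hA hs hniso hslot
  have heC : ∀ c, Nonempty (K' c ≃+* (A' c).endAlgebra) := fun c =>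
    nonempty_ringEquiv_endAlgebra_of_isSimple (hA c) (hs c)
  have hpos : ∀ c, 0 < (A' c).dim := fun c => by
    have h := finrank_eq_two_mul_dim_of_isCMTypeRealisation (hA c)
    have hp : 0 < finrank ℚ (K' c) := Module.finrank_pos
    omega
  have hL : ∀ c, (⨆ f : (A' c).endAlgebra →+* ℂ, IntermediateField.adjoin ℚ (Set.range f)) = normalClosure ℚ (K' c) ℂ :=
    fun c => by obtain ⟨e⟩ := heC c; exact iSup_adjoin_range_eq_normalClosure e
  -- the big slots (dimension `≥ 4`) are generic and split off
  refine (isNondegenerateFamily_iff_of_pairFlip_slots (Φ := Φ') (fun c => 3 < (A' c).dim) (fun c hc => ?_)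
    (fun c c' hcc' hc hc' hLe => ?_) (fun c c' hc hc' hle => ?_)).2 fun hex => ?_
  · obtain ⟨e⟩ := heC c
    exact pairFlip_of_ringEquiv e (hbig _ (hs c) (hslot c) hc)
  · exact hG1 _ _ (hs c) (hs c') (hslot c) (hslot c') hc hc' (hniso c c' hcc') (by rw [hL c, hL c', hLe])
  · exact hG2 _ _ (hs c) (hs c') (hslot c) (hslot c') hc (hpos c') (by omega) (by rw [hL c, hL c']; exact hle)
  · -- the small slots: simple factors of dimension `≤ 3`, decided by the census
    obtain ⟨c₀, hc₀⟩ := hex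
    haveI : Nonempty {c // ¬ 3 < (A' c).dim} := ⟨⟨c₀, hc₀⟩⟩
    exact isNondegenerateFamily_of_factors_dim_le_three (X := X) (K' := fun c : {c // ¬ 3 < (A' c).dim} => K' c.1)
      (Φ' := fun c => Φ' c.1) (A' := fun c => A' c.1) (ι' := fun c => ι' c.1) (θ' := fun c => θ' c.1)
      (fun c => hA c.1) (fun c => hs c.1) (fun c c' hcc' => hniso _ _ fun h => hcc' (Subtype.ext h))
      (fun c => hslot c.1) (fun c => by have := c.2; omega) hi hii hiii

/-- **The Hodge conjecture for everything dominated by a power of a CM abelian variety whose simple factors of dimension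
`≥ 4` are generic with distinct closures off the small ones and whose simple factors of dimension `≤ 3` satisfy the census** —
all Hodge classes polynomials in divisor classes, UNCONDITIONALLY, every dimension. [cite: MoonenZarhin1999LowDim, Thm. (0.2) (4)]
[cite: Gordon1999HodgeAVSurvey, 10.10] -/
theorem hodgeConjectureFor_of_avDominatedBy_powSucc_of_isOfCMType_of_bigGeneric_smallCensus (hcm : IsOfCMType X)
    (hbig : ∀ B : AbelianVariety ℂ, B.IsSimple → AVDominatedBy B X → 3 < B.dim →
      ∀ f : B.endAlgebra →+* ℂ, ∃ σ : ℂ ≃+* ℂ, σ • f = (starRingAut : ℂ ≃+* ℂ) • f ∧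
        ∀ g : B.endAlgebra →+* ℂ, g ≠ f → g ≠ (starRingAut : ℂ ≃+* ℂ) • f → σ • g = g)
    (hG1 : ∀ B B' : AbelianVariety ℂ, B.IsSimple → B'.IsSimple → AVDominatedBy B X → AVDominatedBy B' X →
      3 < B.dim → 3 < B'.dim → ¬ IsIsogenous B B' →
      (⨆ f : B.endAlgebra →+* ℂ, IntermediateField.adjoin ℚ (Set.range f)) ≠
        ⨆ f : B'.endAlgebra →+* ℂ, IntermediateField.adjoin ℚ (Set.range f))
    (hG2 : ∀ B B' : AbelianVariety ℂ, B.IsSimple → B'.IsSimple → AVDominatedBy B X → AVDominatedBy B' X →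
      3 < B.dim → 0 < B'.dim → B'.dim ≤ 3 →
      ¬ (⨆ f : B.endAlgebra →+* ℂ, IntermediateField.adjoin ℚ (Set.range f)) ≤
        ⨆ f : B'.endAlgebra →+* ℂ, IntermediateField.adjoin ℚ (Set.range f))
    (hi : ¬ ∃ (B B' : AbelianVariety ℂ) (k : Type) (_ : Field k) (_ : NumberField k),
      B.IsSimple ∧ B'.IsSimple ∧ 0 < B.dim ∧ 0 < B'.dim ∧ AVDominatedBy B X ∧ AVDominatedBy B' X ∧
      ¬ IsIsogenous B B' ∧ IsTotallyComplex k ∧ finrank ℚ k = 2 ∧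
      Nonempty (k →+* B.endAlgebra) ∧ Nonempty (k →+* B'.endAlgebra))
    (hii : ¬ ∃ T : Fin 4 → AbelianVariety ℂ, (∀ a, (T a).IsSimple ∧ (T a).dim = 3 ∧ AVDominatedBy (T a) X) ∧
      (∀ a b, a ≠ b → ¬ IsIsogenous (T a) (T b)) ∧ ∀ a b, Nonempty ((T a).endAlgebra ≃+* (T b).endAlgebra))
    (hiii : ¬ ∃ S : Fin 3 → AbelianVariety ℂ, (∀ a, (S a).IsSimple ∧ (S a).dim = 2 ∧ AVDominatedBy (S a) X) ∧
      (∀ a b, a ≠ b → ¬ IsIsogenous (S a) (S b)) ∧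
      ∀ a b, (⨆ f : (S a).endAlgebra →+* ℂ, IntermediateField.adjoin ℚ (Set.range f)) =
        ⨆ f : (S b).endAlgebra →+* ℂ, IntermediateField.adjoin ℚ (Set.range f))
    {B : AbelianVariety ℂ} {N : ℕ} (hB : AVDominatedBy B (X.powSucc N)) : HodgeConjectureFor B.dim B.X :=
  hodgeConjectureFor_of_isDivisorGenerated _
    (isDivisorGenerated_of_avDominatedBy_powSucc_of_isOfCMType_of_bigGeneric_smallCensus hcm hbig hG1 hG2 hi hii hiii hB)

end Synthesis

end Summit.HodgeConjecture.CorCM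

end
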